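import Summits.QuantumFields.BalabanUV.T4Continuum.Support.ColourMultiplierRows
import Summits.QuantumFields.BalabanUV.T4Continuum.Support.CovariantBlockAveragingTower

/-!
# T⁴ programme, NE2 (U1a) sub-row Δ3 (`T4-U1a.S-NE2-D3-WALK°`) — WEIGHTED ROWS OF BLOCK-AVERAGING KERNELS: line points lie within one
# block of their base block; kernels dominated by the modulus kernel `qr` of (1.18) have `n`-uniform weighted rows; Bałaban's
# covariant-averaging summand `avgPert = a·n^{d+1}·(Q(R)ᴴQ(R) − QᴴQ ⊗ 1)` has weighted rows `≤ |a|·(card o)²·τ(2+τ)·e^{2δ′}`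

NE2 formalisation swarm `b2b-balaban-t4-ne2-formalise-*`, leaf prover 05 (gen 6); file 1 of the supplier item «NE2-Δ3-TIERB-HDEC» (the `hdec`
input of ROOT B's decay stations for the TYPED tier-B perturbation `balabanPert = covPertC + avgPert + P₄`; INTENT CLAIMS.log 2026-08-20).
 * §1 `circAbs_blockOf_line_sub_le`, `torusSupNorm_rep_sub_comm`, **`torusSupNorm_blockOf_line_le_one`**: the block of a
   line point `n·y + j + t·e_μ` (`t < n`) of King's∕Bałaban's block averaging (1.18) is within ℓ^∞ torus block distance `1` of `y`;
 * §2 **`torusSupNorm_le_one_of_qr_ne_zero`**: the support of pv15's modulus kernel `qr` (`Beta/DeltaACombesThomas` §4) lies within one block;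
 * §3 **`wrow_conjTranspose_mul_le_of_qr`**: for colour-lifted rectangular kernels with `‖E b i‖ ≤ e·qr`, `‖F b i‖ ≤ f·qr`:
   `Σ_{i′} e^{δ′|blk i − blk i′|_∞}‖(EᴴF)(i,i′)‖ ≤ (card o)²·e·f·e^{2δ′}·n^{−(d+1)}` (row sums of `qr` = 1, column sums `n^{−(d+1)}`, `sum_qr_row`∕`sum_qr_col`);
 * §4 **`wrow_avgPert_le`**: with the DISPLAYED transport entry law `hT : ‖T(Γ) − 1‖ ≤ τ` along the canonical contours (the entry-level
   analogue of tier B's displayed transport-error laws `hE`, row B3), `Σ_j e^{δ′ρ}‖(avgPert L M a R k)(i,j)‖ ≤ ‖a‖·(card o)²·τ(2+τ)·e^{2δ′}` at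
   every level — `Qcov = Q⊗1 + E′`, `|E′| ≤ τ·qr` (`CovariantBlockAveraging.norm_Qcov_sub_kron_apply_le`), `|Q⊗1| ≤ qr` (`norm_QvOp_le`),
   `Q(R)ᴴQ(R) − (Q⊗1)ᴴ(Q⊗1) = E′ᴴQ(R) + (Q⊗1)ᴴE′`, §3 twice, the factor `n^{d+1}` cancelled by the column sums.

HONEST FRAMING (T4-DAG p. 1).  [folklore] bookkeeping on landed objects (pv15's `qr`, tier B's `Qcov`∕`avgPert`); `hT` DISPLAYED, not derived
from the regularity class here; a = the averaging weight (any real), dimension `d + 1`; MODEL level; nothing printed asserted ([B5] (1.18) p.20,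
[B9] (3.14)–(3.16) p.393 are TEXT LOCATIONS); Δ3 NOT closed; **NE2 (U1a) NOT PROVED**; spine PROVED 0/9; NOT infinite volume, NOT a mass gap,
NOT Clay.  HONEST DEPENDENCY: continuum YM on T⁴ ⇐ BetaPertH ∧ nine spine estimates (0/9 proved); BetaPertH ⇐ (D1) ∧ (D4) ∧ CAP+tail; G-an2-4
gates asym, D1 and NE2/3/4.  ABSOLUTE RULE kept; no `def`; no `sorry`.
-/

noncomputable section

open scoped BigOperators ComplexConjugate Matrix Matrix.Norms.L2Operator Kronecker
open Finset

namespace Summit.QuantumFields.BalabanUV.T4Continuum.AveragingKernelRows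

open Literature.MathematicalPhysics.QuantumFieldTheory.Balaban1983to89.B5Prop11Plancherel (Tor fine unitVec)
open Literature.MathematicalPhysics.QuantumFieldTheory.Balaban1983to89.B4TorusKernel.MultiPeriod (torusSupNorm circAbs circAbs_le_abs
  circAbs_add_mul)
open Literature.MathematicalPhysics.QuantumFieldTheory.Balaban1983to89.B4Sect5Torus (circAbs_zero circAbs_neg)
open Literature.MathematicalPhysics.QuantumFieldTheory.Balaban1983to89.B5Blocks16 (blockOf bpt_val blockOf_bpt)
open Literature.MathematicalPhysics.QuantumFieldTheory.Balaban1983to89.B5Block118 (bpt tstep QvOp)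
open Literature.MathematicalPhysics.QuantumFieldTheory.Balaban1983to89.B6LowerBound2153Torus (rep)
open Literature.MathematicalPhysics.QuantumFieldTheory.Balaban1983to89.B6Cov2156Torus (one_le_M)
open Literature.MathematicalPhysics.QuantumFieldTheory.Balaban1983to89.Beta.DeltaACombesThomas (qr qr_nonneg qr_ne_zero sum_qr_row sum_qr_col
  norm_QvOp_le)
open Summit.QuantumFields.BalabanUV.T4Continuum
open Summit.QuantumFields.BalabanUV.T4Continuum.SmallCouplingEntryDecay (torusSupNorm_rep_triangle torusSupNorm_rep_nonneg)

variable {d : ℕ} (n : ℕ) [NeZero n] (M : Fin (d + 1) → ℕ) [hM : ∀ μ, NeZero (M μ)]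

/-- the block of a line point `n·y + j + t·e_μ` (`t < n`) is within block distance `1` of `y`, coordinatewise. [folklore] -/
theorem circAbs_blockOf_line_sub_le (y : Tor M) (j : Fin (d + 1) → Fin n) (μ : Fin (d + 1)) (t : Fin n) (ν : Fin (d + 1)) :
    circAbs (M ν) (((blockOf n M (bpt n M y j + tstep (fine n M) μ t) ν).val : ℤ) - ((y ν).val : ℤ)) ≤ 1 := by
  have hM1 : 1 ≤ M ν := one_le_M M ν
  have hn : 0 < n := Nat.pos_of_ne_zero (NeZero.ne n)
  rw [ColourMultiplierRows.val_blockOf]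
  have hval : ((bpt n M y j + tstep (fine n M) μ t) ν).val = (n * (y ν).val + j ν + (if ν = μ then (t : ℕ) else 0)) % (fine n M ν) := by
    rw [Pi.add_apply, ZMod.val_add, bpt_val, tstep]
    by_cases h : ν = μ
    · rw [if_pos h, if_pos h, ZMod.val_natCast, Nat.add_mod_mod]
    · rw [if_neg h, if_neg h, ZMod.val_zero, add_zero]
  rw [hval]
  set s : ℕ := j ν + (if ν = μ then (t : ℕ) else 0) with hs
  have hs2 : s < 2 * n := by
    have hj : (j ν : ℕ) < n := (j ν).isLt
    have ht : (if ν = μ then (t : ℕ) else 0) < n := by split_ifs <;> [exact t.isLt; exact hn]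
    omega
  have hy : (y ν).val < M ν := ZMod.val_lt _
  have hm : fine n M ν = n * M ν := rfl
  rw [show n * (y ν).val + j ν + (if ν = μ then (t : ℕ) else 0) = n * (y ν).val + s by rw [hs]; ring]
  by_cases hlt : n * (y ν).val + s < n * M ν
  · rw [hm, Nat.mod_eq_of_lt hlt, Nat.mul_add_div hn]
    have hsn : s / n ≤ 1 := by
      rw [Nat.div_le_iff_le_mul_add_pred hn]; omega
    rcases Nat.le_one_iff_eq_zero_or_eq_one.mp hsn with h0 | h1
    · rw [h0, add_zero, sub_self, circAbs_zero]; norm_num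
    · rw [h1]; push_cast
      rw [show ((y ν).val : ℤ) + 1 - ((y ν).val : ℤ) = 1 by ring]
      exact (circAbs_le_abs hM1 1).trans (by norm_num)
  · -- wrap: `y_ν = M − 1` and `s ≥ n`: the value is `s − n < n`, block `0`
    have hge : n * M ν ≤ n * (y ν).val + s := Nat.le_of_not_lt hlt
    have hyM : (y ν).val = M ν - 1 := by
      by_contra hne
      have h2 : n * ((y ν).val + 2) ≤ n * M ν := Nat.mul_le_mul_left n (by omega)
      rw [Nat.mul_add] at h2
      omega
    have hnM : n * M ν = n * (y ν).val + n := by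
      have h1 : n * M ν = n * (M ν - 1) + n := by
        rw [Nat.mul_sub, mul_one, Nat.sub_add_cancel (Nat.le_mul_of_pos_right n hM1)]
      rw [h1, hyM]
    have hval2 : (n * (y ν).val + s) % (n * M ν) = n * (y ν).val + s - n * M ν := by
      rw [Nat.mod_eq_sub_mod hge, Nat.mod_eq_of_lt]
      omega
    have hsmall : n * (y ν).val + s - n * M ν < n := by omega
    rw [hm, hval2, Nat.div_eq_of_lt hsmall, hyM, Nat.cast_zero]
    obtain ⟨K, hK⟩ : ∃ K, M ν = K + 1 := ⟨M ν - 1, by omega⟩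
    rw [hK, Nat.add_sub_cancel, show (0 : ℤ) - ((K : ℕ) : ℤ) = 1 + ((K + 1 : ℕ) : ℤ) * (-1) by push_cast; ring, circAbs_add_mul]
    exact (circAbs_le_abs (by omega) 1).trans (by norm_num)

omit [NeZero n] in
/-- symmetry of the block distance. [folklore] -/
theorem torusSupNorm_rep_sub_comm (a b : Tor M) : torusSupNorm M (rep M a - rep M b) = torusSupNorm M (rep M b - rep M a) := by
  unfold torusSupNorm
  congr 1; funext μ
  rw [show (rep M a - rep M b) μ = -((rep M b - rep M a) μ) by simp only [Pi.sub_apply]; ring, circAbs_neg (one_le_M M μ)]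

/-- **A LINE POINT OF THE BLOCK AVERAGING LIES WITHIN BLOCK DISTANCE ONE OF ITS BASE BLOCK**:
`|blk(n·y + j + t·e_μ) − y|_{T₁,∞} ≤ 1` for `t < n`. [cite: Balaban1984PropagatorsI, (1.18) p.20 (shape of the averaging)] [folklore] -/
theorem torusSupNorm_blockOf_line_le_one (y : Tor M) (j : Fin (d + 1) → Fin n) (μ : Fin (d + 1)) (t : Fin n) :
    torusSupNorm M (rep M (blockOf n M (bpt n M y j + tstep (fine n M) μ t)) - rep M y) ≤ 1 := by
  unfold torusSupNorm
  refine Finset.sup'_le _ _ fun ν _ => ?_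
  have h := circAbs_blockOf_line_sub_le n M y j μ t ν
  show ((circAbs (M ν) (((blockOf n M (bpt n M y j + tstep (fine n M) μ t) ν).val : ℤ) - ((y ν).val : ℤ)) : ℤ) : ℝ) ≤ 1
  exact_mod_cast h


/-- **THE SUPPORT OF `qr`**: `qr((y,μ), x) ≠ 0 ⟹ |blk(x) − y|_{T₁,∞} ≤ 1`. [folklore] -/
theorem torusSupNorm_le_one_of_qr_ne_zero (b : Tor M × Fin (d + 1)) (x : Tor (fine n M) × Fin (d + 1)) (h : qr n M b x ≠ 0) :
    torusSupNorm M (rep M (blockOf n M x.1) - rep M b.1) ≤ 1 := by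
  obtain ⟨j, t, hx⟩ := qr_ne_zero n M b x h
  rw [hx]
  exact torusSupNorm_blockOf_line_le_one n M b.1 j b.2 t


variable {o : Type*} [Fintype o]

/-- **WEIGHTED ROWS OF `Eᴴ·F` FOR KERNELS DOMINATED BY THE BLOCK-AVERAGING MODULUS KERNEL `qr`**: if `‖E b i‖ ≤ e·qr(b,i)` and
`‖F b i‖ ≤ f·qr(b,i)` (colour-lifted indices), then at every row `Σ_{i′} e^{δ′|blk i − blk i′|_∞}‖(EᴴF)(i,i′)‖ ≤ (card o)²·e·f·e^{2δ′}·n^{−(d+1)}`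
— both supports lie within one block of the base block (weight `≤ e^{2δ′}`), row sums of `qr` are `1`, column sums `n^{−(d+1)}`. [folklore] -/
theorem wrow_conjTranspose_mul_le_of_qr {E F : Matrix ((Tor M × Fin (d + 1)) × o) ((Tor (fine n M) × Fin (d + 1)) × o) ℂ} {e f : ℝ}
    (he : 0 ≤ e) (hE : ∀ b i, ‖E b i‖ ≤ e * qr n M b.1 i.1) (hF : ∀ b i, ‖F b i‖ ≤ f * qr n M b.1 i.1)
    {δ' : ℝ} (hδ : 0 ≤ δ') (i : (Tor (fine n M) × Fin (d + 1)) × o) :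
    ∑ i' : (Tor (fine n M) × Fin (d + 1)) × o,
        Real.exp (δ' * torusSupNorm M (rep M (blockOf n M i.1.1) - rep M (blockOf n M i'.1.1))) * ‖(Eᴴ * F) i i'‖
      ≤ (Fintype.card o : ℝ) ^ 2 * (e * f) * Real.exp (2 * δ') * (1 / (n : ℝ) ^ (d + 1)) := by
  -- entrywise domination by `Σ_b e·qr(b,i)·f·qr(b,i′)` with the weight absorbed on the joint support
  have hterm : ∀ i', Real.exp (δ' * torusSupNorm M (rep M (blockOf n M i.1.1) - rep M (blockOf n M i'.1.1))) * ‖(Eᴴ * F) i i'‖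
      ≤ ∑ b : (Tor M × Fin (d + 1)) × o, Real.exp (2 * δ') * (e * qr n M b.1 i.1) * (f * qr n M b.1 i'.1) := by
    intro i'
    rw [Matrix.mul_apply]
    calc Real.exp (δ' * _) * ‖∑ b, (Eᴴ) i b * F b i'‖
        ≤ Real.exp (δ' * _) * ∑ b, ‖E b i‖ * ‖F b i'‖ := by
          refine mul_le_mul_of_nonneg_left ((norm_sum_le _ _).trans (Finset.sum_le_sum fun b _ => ?_)) (Real.exp_pos _).le
          rw [Matrix.conjTranspose_apply, norm_mul, norm_star]
      _ = ∑ b, Real.exp (δ' * torusSupNorm M (rep M (blockOf n M i.1.1) - rep M (blockOf n M i'.1.1))) * (‖E b i‖ * ‖F b i'‖) := by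
          rw [Finset.mul_sum]
      _ ≤ ∑ b : (Tor M × Fin (d + 1)) × o, Real.exp (2 * δ') * (e * qr n M b.1 i.1) * (f * qr n M b.1 i'.1) := by
          refine Finset.sum_le_sum fun b _ => ?_
          by_cases h1 : qr n M b.1 i.1 = 0
          · have : ‖E b i‖ = 0 := le_antisymm (by simpa [h1] using hE b i) (norm_nonneg _)
            rw [this, zero_mul, mul_zero, h1, mul_zero, mul_zero, zero_mul]
          by_cases h2 : qr n M b.1 i'.1 = 0
          · have : ‖F b i'‖ = 0 := le_antisymm (by simpa [h2] using hF b i') (norm_nonneg _)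
            rw [this, mul_zero, mul_zero, h2, mul_zero, mul_zero]
          have hT : torusSupNorm M (rep M (blockOf n M i.1.1) - rep M (blockOf n M i'.1.1)) ≤ 2 := by
            have t1 := torusSupNorm_le_one_of_qr_ne_zero n M b.1 i.1 h1
            have t2 := torusSupNorm_le_one_of_qr_ne_zero n M b.1 i'.1 h2
            rw [torusSupNorm_rep_sub_comm] at t2
            linarith [torusSupNorm_rep_triangle M (blockOf n M i.1.1) b.1.1 (blockOf n M i'.1.1)]
          have hw : Real.exp (δ' * torusSupNorm M (rep M (blockOf n M i.1.1) - rep M (blockOf n M i'.1.1))) ≤ Real.exp (2 * δ') :=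
            Real.exp_le_exp.mpr (by nlinarith)
          calc Real.exp (δ' * _) * (‖E b i‖ * ‖F b i'‖)
              ≤ Real.exp (2 * δ') * ((e * qr n M b.1 i.1) * (f * qr n M b.1 i'.1)) :=
                mul_le_mul hw (mul_le_mul (hE b i) (hF b i') (norm_nonneg _) (mul_nonneg he (qr_nonneg n M _ _)))
                  (mul_nonneg (norm_nonneg _) (norm_nonneg _)) (Real.exp_pos _).le
            _ = _ := by ring
  -- sum over `i′` (row sums of `qr` = 1 per colour) and over `b` (column sums = n^{−(d+1)} per colour)
  calc ∑ i', Real.exp (δ' * torusSupNorm M (rep M (blockOf n M i.1.1) - rep M (blockOf n M i'.1.1))) * ‖(Eᴴ * F) i i'‖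
      ≤ ∑ i' : (Tor (fine n M) × Fin (d + 1)) × o, ∑ b : (Tor M × Fin (d + 1)) × o,
          Real.exp (2 * δ') * (e * qr n M b.1 i.1) * (f * qr n M b.1 i'.1) := Finset.sum_le_sum fun i' _ => hterm i'
    _ = ∑ b : (Tor M × Fin (d + 1)) × o, Real.exp (2 * δ') * (e * qr n M b.1 i.1) * (f * ∑ i' : (Tor (fine n M) × Fin (d + 1)) × o, qr n M b.1 i'.1) := by
        rw [Finset.sum_comm]
        refine Finset.sum_congr rfl fun b _ => ?_
        rw [Finset.mul_sum, Finset.mul_sum]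
    _ = ∑ b : (Tor M × Fin (d + 1)) × o, Real.exp (2 * δ') * (e * qr n M b.1 i.1) * (f * (Fintype.card o : ℝ)) := by
        refine Finset.sum_congr rfl fun b _ => ?_
        have hrow : ∑ i' : (Tor (fine n M) × Fin (d + 1)) × o, qr n M b.1 i'.1 = (Fintype.card o : ℝ) := by
          rw [Fintype.sum_prod_type_right, Finset.sum_comm]
          simp only [Finset.sum_const, Finset.card_univ, nsmul_eq_mul]
          rw [← Finset.mul_sum, sum_qr_row, mul_one]
        rw [hrow]
    _ = Real.exp (2 * δ') * e * (f * (Fintype.card o : ℝ)) * ∑ b : (Tor M × Fin (d + 1)) × o, qr n M b.1 i.1 := by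
        rw [Finset.mul_sum]; refine Finset.sum_congr rfl fun b _ => by ring
    _ = Real.exp (2 * δ') * e * (f * (Fintype.card o : ℝ)) * ((Fintype.card o : ℝ) * (1 / (n : ℝ) ^ (d + 1))) := by
        have hcol : ∑ b : (Tor M × Fin (d + 1)) × o, qr n M b.1 i.1 = (Fintype.card o : ℝ) * (1 / (n : ℝ) ^ (d + 1)) := by
          rw [Fintype.sum_prod_type, Finset.sum_comm]
          simp only [Finset.sum_const, Finset.card_univ, nsmul_eq_mul]
          rw [sum_qr_col]
        rw [hcol]
    _ = (Fintype.card o : ℝ) ^ 2 * (e * f) * Real.exp (2 * δ') * (1 / (n : ℝ) ^ (d + 1)) := by ring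

/-! ## §4 The covariant-averaging Gram difference `Q(R)ᴴQ(R) − (QᴴQ) ⊗ 1` -/

section Gram

open Summit.QuantumFields.BalabanUV.T4Continuum.CovariantBlockAveraging (Qcov contour transport norm_Qcov_sub_kron_apply_le QcovLev)
open Summit.QuantumFields.BalabanUV.T4Continuum.BalabanAveragedTowerUnit (idx)
open Literature.MathematicalPhysics.QuantumFieldTheory.Balaban1983to89.B5G183RateUnitTower (lev)

variable (L : ℕ) [NeZero L] (M : Fin (d + 1) → ℕ) [hM : ∀ μ, NeZero (M μ)]
variable {o : Type*} [Fintype o] [DecidableEq o]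

omit hM [Fintype o] in
/-- `|(Q ⊗ 1)(b, i)| ≤ qr(b, i)`. [folklore] -/
theorem norm_kron_QvOp_le (n : ℕ) [NeZero n] (b : (Tor M × Fin (d + 1)) × o) (i : (Tor (fine n M) × Fin (d + 1)) × o) :
    ‖(QvOp n M ⊗ₖ (1 : Matrix o o ℂ)) b i‖ ≤ qr n M b.1 i.1 := by
  rw [Matrix.kroneckerMap_apply, Matrix.one_apply, norm_mul]
  split_ifs
  · rw [norm_one, mul_one]; exact norm_QvOp_le n M b.1 i.1
  · rw [norm_zero, mul_zero]; exact qr_nonneg n M b.1 i.1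

/-- `(QᴴQ) ⊗ 1 = (Q ⊗ 1)ᴴ(Q ⊗ 1)`. [folklore] -/
theorem kron_gram_eq (n : ℕ) [NeZero n] :
    ((QvOp n M)ᴴ * QvOp n M) ⊗ₖ (1 : Matrix o o ℂ) = (QvOp n M ⊗ₖ (1 : Matrix o o ℂ))ᴴ * (QvOp n M ⊗ₖ (1 : Matrix o o ℂ)) := by
  rw [Matrix.conjTranspose_kronecker, Matrix.conjTranspose_one, ← Matrix.mul_kronecker_mul, Matrix.one_mul]

/-- the algebra: `Q(R)ᴴQ(R) − (Q⊗1)ᴴ(Q⊗1) = (Q(R) − Q⊗1)ᴴ·Q(R) + (Q⊗1)ᴴ·(Q(R) − Q⊗1)`. [folklore] -/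
theorem gram_sub_gram_eq {m k : Type*} [Fintype m] [Fintype k] (A B : Matrix m k ℂ) :
    Aᴴ * A - Bᴴ * B = (A - B)ᴴ * A + Bᴴ * (A - B) := by
  rw [Matrix.conjTranspose_sub, Matrix.sub_mul, Matrix.mul_sub]
  abel

/-- **WEIGHTED ROWS OF THE COVARIANT-AVERAGING GRAM DIFFERENCE**: under the DISPLAYED transport entry law
`hT : ‖T(Γ_{y,j,μ,t}) − 1‖ ≤ τ` along the canonical contours at level `k` (the entry-level analogue of tier B's displayed transport-error
laws, row B3), `Σ_j e^{δ′|blk i − blk j|_∞}‖(Q_k(R_k)ᴴQ_k(R_k) − (Q_kᴴQ_k) ⊗ 1)(i,j)‖ ≤ (card o)²·τ(2+τ)·e^{2δ′}·n_k^{−(d+1)}` — so that Bałaban's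
summand `a·n_k^{d+1}·(…)` (`NE2BalabanRoot.avgPert`) has level-uniform weighted rows `≤ |a|·(card o)²·τ(2+τ)·e^{2δ′}`. [folklore] -/
theorem wrow_gram_sub_le {R : (k : ℕ) → Fin (d + 1) → (idx L M k → Matrix o o ℂ)} {τ : ℝ} (hτ : 0 ≤ τ) (k : ℕ)
    (hT : ∀ y j μ (t : Fin (lev L k)), ‖transport (fine (lev L k) M) (R k) μ (contour (lev L k) M y j μ t) - 1‖ ≤ τ)
    {δ' : ℝ} (hδ : 0 ≤ δ') (i : idx L M k × o) :
    ∑ j : idx L M k × o, Real.exp (δ' * torusSupNorm M (rep M (blockOf (lev L k) M i.1.1) - rep M (blockOf (lev L k) M j.1.1)))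
        * ‖((QcovLev L M R k)ᴴ * QcovLev L M R k - ((QvOp (lev L k) M)ᴴ * QvOp (lev L k) M) ⊗ₖ (1 : Matrix o o ℂ)) i j‖
      ≤ (Fintype.card o : ℝ) ^ 2 * (τ * (2 + τ)) * Real.exp (2 * δ') * (1 / ((lev L k : ℕ) : ℝ) ^ (d + 1)) := by
  have hE : ∀ b j, ‖(QcovLev L M R k - QvOp (lev L k) M ⊗ₖ (1 : Matrix o o ℂ)) b j‖ ≤ τ * qr (lev L k) M b.1 j.1 :=
    fun b j => norm_Qcov_sub_kron_apply_le (lev L k) M (contour (lev L k) M) hτ (hT) b j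
  have hQ1 : ∀ b j, ‖(QvOp (lev L k) M ⊗ₖ (1 : Matrix o o ℂ)) b j‖ ≤ 1 * qr (lev L k) M b.1 j.1 :=
    fun b j => by rw [one_mul]; exact norm_kron_QvOp_le M (lev L k) b j
  have hQc : ∀ b j, ‖QcovLev L M R k b j‖ ≤ (1 + τ) * qr (lev L k) M b.1 j.1 := by
    intro b j
    have e : QcovLev L M R k b j = (QvOp (lev L k) M ⊗ₖ (1 : Matrix o o ℂ)) b j + (QcovLev L M R k - QvOp (lev L k) M ⊗ₖ (1 : Matrix o o ℂ)) b j := by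
      rw [Matrix.sub_apply, add_sub_cancel]
    rw [e]
    calc _ ≤ ‖(QvOp (lev L k) M ⊗ₖ (1 : Matrix o o ℂ)) b j‖ + ‖(QcovLev L M R k - QvOp (lev L k) M ⊗ₖ (1 : Matrix o o ℂ)) b j‖ := norm_add_le _ _
      _ ≤ 1 * qr (lev L k) M b.1 j.1 + τ * qr (lev L k) M b.1 j.1 := add_le_add (hQ1 b j) (hE b j)
      _ = (1 + τ) * qr (lev L k) M b.1 j.1 := by ring
  have hw : ∀ i j : idx L M k × o,
      0 ≤ Real.exp (δ' * torusSupNorm M (rep M (blockOf (lev L k) M i.1.1) - rep M (blockOf (lev L k) M j.1.1))) :=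
    fun _ _ => (Real.exp_pos _).le
  rw [kron_gram_eq, gram_sub_gram_eq]
  refine (SmallCouplingEntryDecayGrad.wrow_add_le (fun i j : idx L M k × o => Real.exp (δ' * torusSupNorm M
      (rep M (blockOf (lev L k) M i.1.1) - rep M (blockOf (lev L k) M j.1.1)))) hw _ _ i).trans ?_
  have h1 := wrow_conjTranspose_mul_le_of_qr (lev L k) M hτ hE hQc hδ i
  have h2 := wrow_conjTranspose_mul_le_of_qr (lev L k) M zero_le_one hQ1 hE hδ i
  calc _ ≤ (Fintype.card o : ℝ) ^ 2 * (τ * (1 + τ)) * Real.exp (2 * δ') * (1 / ((lev L k : ℕ) : ℝ) ^ (d + 1))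
        + (Fintype.card o : ℝ) ^ 2 * (1 * τ) * Real.exp (2 * δ') * (1 / ((lev L k : ℕ) : ℝ) ^ (d + 1)) := add_le_add h1 h2
    _ = _ := by ring

end Gram

end Summit.QuantumFields.BalabanUV.T4Continuum.AveragingKernelRows

end
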